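import Literature.NumberTheory.LFunctions.WeilTwoPrimeDeflL2Base
import Literature.NumberTheory.LFunctions.WeilBlockRowsPZ
import HarnessLib

/-!
# Deflated two-prime certificate L2: the factored even inverse agrees with `D`, rows 24–31

`WeilCert.checkDnRow` (even block) for certificate L2, by `decide +kernel`. Pure proof file.
-/

noncomputable section

namespace Literature.NumberTheory.LFunctions

set_option maxHeartbeats 0 in
/-- Row 24 of `DnE/LsE` is row 24 of the even `D` (certificate L2). [folklore] -/
theorem checkDnRow0_24_weilCertDeflL2 : weilCertDeflL2Base.checkDnRow weilCertDeflL2DnE weilCertDeflL2LsE 0 24 = true := by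
  decide +kernel

set_option maxHeartbeats 0 in
/-- Row 25 of `DnE/LsE` is row 25 of the even `D` (certificate L2). [folklore] -/
theorem checkDnRow0_25_weilCertDeflL2 : weilCertDeflL2Base.checkDnRow weilCertDeflL2DnE weilCertDeflL2LsE 0 25 = true := by
  decide +kernel

set_option maxHeartbeats 0 in
/-- Row 26 of `DnE/LsE` is row 26 of the even `D` (certificate L2). [folklore] -/
theorem checkDnRow0_26_weilCertDeflL2 : weilCertDeflL2Base.checkDnRow weilCertDeflL2DnE weilCertDeflL2LsE 0 26 = true := by
  decide +kernel

set_option maxHeartbeats 0 in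
/-- Row 27 of `DnE/LsE` is row 27 of the even `D` (certificate L2). [folklore] -/
theorem checkDnRow0_27_weilCertDeflL2 : weilCertDeflL2Base.checkDnRow weilCertDeflL2DnE weilCertDeflL2LsE 0 27 = true := by
  decide +kernel

set_option maxHeartbeats 0 in
/-- Row 28 of `DnE/LsE` is row 28 of the even `D` (certificate L2). [folklore] -/
theorem checkDnRow0_28_weilCertDeflL2 : weilCertDeflL2Base.checkDnRow weilCertDeflL2DnE weilCertDeflL2LsE 0 28 = true := by
  decide +kernel

set_option maxHeartbeats 0 in
/-- Row 29 of `DnE/LsE` is row 29 of the even `D` (certificate L2). [folklore] -/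
theorem checkDnRow0_29_weilCertDeflL2 : weilCertDeflL2Base.checkDnRow weilCertDeflL2DnE weilCertDeflL2LsE 0 29 = true := by
  decide +kernel

set_option maxHeartbeats 0 in
/-- Row 30 of `DnE/LsE` is row 30 of the even `D` (certificate L2). [folklore] -/
theorem checkDnRow0_30_weilCertDeflL2 : weilCertDeflL2Base.checkDnRow weilCertDeflL2DnE weilCertDeflL2LsE 0 30 = true := by
  decide +kernel

set_option maxHeartbeats 0 in
/-- Row 31 of `DnE/LsE` is row 31 of the even `D` (certificate L2). [folklore] -/
theorem checkDnRow0_31_weilCertDeflL2 : weilCertDeflL2Base.checkDnRow weilCertDeflL2DnE weilCertDeflL2LsE 0 31 = true := by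
  decide +kernel


end Literature.NumberTheory.LFunctions
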